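import Summits.QuantumFields.YangMills.Theorems.UnitScaleTiltProp7LineOfTransportedFamily
import Summits.QuantumFields.YangMills.Theorems.UnitScaleTiltProp7TowerWalkTransport
import Summits.QuantumFields.YangMills.Theorems.UnitScaleTiltProp7OneStrokeSplit
import HarnessLib

/-!
# Route `UnitScaleTilt`, crux K1 «MinimiserStabilityRegPr» (stmt-QuantumFields-19200), route-R [RP] curved, the curved N6 row (R-C), transport geometry, Step A+B assembled —
# THE PURE `LINE`-ITERATE `S_k` IS A TRANSPORTED FAMILY OVER THE ONE-STROKE INDEX SET: every term is `Ad_τ Y(x + te_μ, μ)` with `(x, t)` running `(d!)^{2k}` times over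
# `B^k(c₋) × [0, L^k)`, and every transport `τ` is within `η_k` of the `U₀`-holonomy of an explicit fine word from the `k`-centre `embIter k c₋` of length `≤ len_k` and
# net displacement `r − H_k + t·e_μ` (so Step C compares it with the engine's corner word by perimeter Stokes, and Step D sums the squares)

Cell `ym3-torus`, width seat `ym-ust-20520-w2` (g3).  The assembly of Steps A–B of the memo `RC-TRANSPORT-GEOMETRY-w2g3.md` (19200 evidence #44) from this seat's letters:
✓ p609588 `line_of_transported_family_fin` (one level of `LINE` on a transported family), `…OneStrokeSplit` (`oneStroke_src_succ`, `sum_oneStroke_succ`: the one-stroke index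
splits level by level), `…TowerWalkTransport.norm_holAt_iter_walk_sub_dilated_le` (tower holonomies = `U₀` along dilated words up to `|w|θ_k`), ★p1's `walkEnd_embIter_flatMap`.
THEOREMS ONLY (0 `def`, 0 `sorry`); `--supports stmt-QuantumFields-19200`, count-neutral.  YM₃ on T³ is a ladder rung (R3), not the Clay problem; nothing here claims the curved N6
in full, S2, P, the crux or the gap.

THE INVARIANT (existential over the index TYPE, uniform in the coarse bond; recursion families `θ, η : ℕ → ℝ`, `len, H : ℕ → ℕ` displayed by their one-step inequalities):
for the pure family `S 0 = Y`, `S (j+1) c = LINE_{Ū₀^{(j)}}(S j)(c)`, at every level `k ≤ m + K` there are a finite type `Ω` and maps `τ` (transports), `ρ` (fibre offsets),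
`t` (step counts), `W` (fine words) on `PBond P k × Ω` with
(I1) `S k c = (|I|^k)⁻¹ • Σ_ω τ·Y⟨shift^{t}(fibreSite 0 k c₋ ρ), μ_c⟩·τ*`; (I2) `t < L^k`; (I3) `‖τ − U₀(walk (embIter k c₋) W)‖ ≤ η k`; (I4) `|W| ≤ len k`;
(I5) `netDisp W ν = ρ_ν − H k + [ν = μ_c]·t`; (I6) for every additive test function `F`, `Σ_ω F(ρ ω, t ω) = ((d!)²)^k • Σ_{r}Σ_{t<L^k} F(r, t)`.

WHAT IS PROVED (ns `…Theorems.Prop7LineIterRepr`): `walkEnd_replicate_true_eq_iterate`, `fibreSite_zero_const`, ★★★ `exists_lineIter_repr` (the invariant, by induction on `k`).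
HONEST SCOPE.  With Step C (✓ p610318) and Step D (✓ p609108) this leaves, for `hA` of ✓ p601741, only the engine-side dictionary (`holT∕treeWord∕unitsField` at the `k`-corner ↔
`holAt∕walk`, cf. ★routeR-w2 g0's FILE 2b at one level) and the final `Σ_cE_c²` knit.

References: T. Bałaban, CMP 95 (1984) 17–40 [Balaban1984PropagatorsI] ((1.18)–(1.20) pp.19–20); CMP 98 (1985) 17–51 [Balaban1985Averaging] ((58) p.27, (125) p.36);
CMP 109 (1987) 249–301 [Balaban1987RG1] ((0.1)–(0.4), (0.11) pp.252–253).
-/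

noncomputable section

open scoped BigOperators Matrix.Norms.L2Operator

namespace Summit.QuantumFields.YangMills.Theorems.Prop7LineIterRepr

open Literature.MathematicalPhysics.QuantumFieldTheory.Balaban1983to89
open Finset T4Continuum T4ReflectionCone BlockAveraging AveragingRT ExpMeanLog BlockAveragingEMLLinearised BlockAveragingEMLLinearisedBackground B1RG242Torus
open B15DeterminingSets (embIter)
open Summit.QuantumFields.YangMills.Theorems.Prop7HolRatioPerStep (norm_coe_eq_one norm_star_coe_eq_one)
open Summit.QuantumFields.YangMills.Theorems.Prop7FlatHolonomy (walkEnd_embIter_flatMap holAt_walk_append netDisp_flatMap_replicate)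
open Summit.QuantumFields.YangMills.Theorems.Prop7FlatCoercivity (sitesPerDir_zero_eq_pow_mul)
open Summit.QuantumFields.YangMills.Theorems.Prop7LineOfTransportedFamily (line_of_transported_family_fin)
open Summit.QuantumFields.YangMills.Theorems.Prop7TowerWalkTransport (norm_holAt_iter_walk_sub_dilated_le)
open Summit.QuantumFields.YangMills.Theorems.Prop7OneStrokeSplit (oneStroke_src_succ sum_oneStroke_succ)

variable {P : Params} {n : Type*} [Fintype n] [DecidableEq n] [Nonempty n]

/-! ## §1 Two small lattice letters -/

omit [Fintype n] [DecidableEq n] [Nonempty n] in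
/-- `walkEnd x (m forward steps e_μ) = shift^m x`. [folklore] -/
theorem walkEnd_replicate_true_eq_iterate {j : ℕ} (μ : Fin P.d) : ∀ (m : ℕ) (x : Site P j),
    walkEnd x (List.replicate m (μ, true)) = (fun z : Site P j => z.shift μ)^[m] x
  | 0, x => by simp [walkEnd]
  | m + 1, x => by
    rw [List.replicate_succ, walkEnd, walkEnd_replicate_true_eq_iterate μ m (x.shift μ)]
    simp only [Function.iterate_succ_apply]

omit [Fintype n] [DecidableEq n] [Nonempty n] in
/-- The zero-fold fibre of a site is the site: `fibreSite 0 0 y r = y`. [folklore] -/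
theorem fibreSite_zero_const (y : Site P 0) (r : Fin P.d → Fin (P.L ^ 0)) : Site.fibreSite 0 0 y r = y := by
  funext ν
  simp [Site.fibreSite]

/-! ## §2 ★★★ The representation of the pure `LINE`-iterate over the one-stroke index set -/

/-- ★★★ **`S_k` AS A TRANSPORTED FAMILY OVER THE ONE-STROKE INDEX SET, WITH TRANSPORTS CLOSE TO `U₀`-HOLONOMIES OF EXPLICIT FINE WORDS.**  Background tower
`Ū₀^{(j)} = Averaging.iter (blockAvg ℰp) j U₀` with per-level loop sizes `dist1(W^{(j)}_i(c)) ≤ a j ≤ 1/6`, `a j < δ_N` (`j < k`); `θ ≥ 0` dominating `2a_j + Lθ_j`,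
`η` dominating `(d+2)L·θ_j + η_j` (`0 ≤ η 0`), `len` dominating `L^j(d+2)L + len_j`, `H 0 = 0`, `H (j+1) = ((L−1)/2)L^j + H j`; `S` the pure `LINE` recursion family.
Then for every `k ≤ m + K` the invariant (I1)–(I6) of the module docstring holds. [cite: Balaban1984PropagatorsI, (1.18) p.20; Balaban1985Averaging, (125) p.36] -/
theorem exists_lineIter_repr (U₀ : GaugeField P 0 (Matrix.specialUnitaryGroup n ℂ)) (Y : PBond P 0 → Matrix n n ℂ)
    (S : (k : ℕ) → PBond P k → Matrix n n ℂ) (hS0 : ∀ b, S 0 b = Y b)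
    (hSs : ∀ (k : ℕ) (c : PBond P (k + 1)), S (k + 1) c
      = ((Fintype.card (Idx P) : ℂ))⁻¹ • ∑ i : Idx P,
          ((holAt (Averaging.iter (fun i => blockAvg (P := P) (j := i) (expMeanLogSU (n := n))) k U₀) (walk (emb c.src) (stairWord i.2.1 (off i.1))) :
              Matrix.specialUnitaryGroup n ℂ) : Matrix n n ℂ) *
            covWalkSum (Averaging.iter (fun i => blockAvg (P := P) (j := i) (expMeanLogSU (n := n))) k U₀) (S k)
              (walk (walkEnd (emb c.src) (stairWord i.2.1 (off i.1))) (List.replicate P.L (c.dir, true))) *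
          star ((holAt (Averaging.iter (fun i => blockAvg (P := P) (j := i) (expMeanLogSU (n := n))) k U₀) (walk (emb c.src) (stairWord i.2.1 (off i.1))) :
              Matrix.specialUnitaryGroup n ℂ) : Matrix n n ℂ))
    (a θ η : ℕ → ℝ) (len H : ℕ → ℕ) (hθ0 : ∀ j, 0 ≤ θ j) (hθ : ∀ j, 2 * a j + P.L * θ j ≤ θ (j + 1)) (hη0 : 0 ≤ η 0)
    (hη : ∀ j, (((P.d + 2) * P.L : ℕ) : ℝ) * θ j + η j ≤ η (j + 1)) (hlen : ∀ j, P.L ^ j * ((P.d + 2) * P.L) + len j ≤ len (j + 1))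
    (hH0 : H 0 = 0) (hH : ∀ j, H (j + 1) = (P.L - 1) / 2 * P.L ^ j + H j) :
    ∀ k : ℕ, k ≤ P.m + P.K →
      (∀ j < k, ∀ (c : PBond P (j + 1)) (i : Idx P),
        dist1 (loopHol (Averaging.iter (fun i => blockAvg (P := P) (j := i) (expMeanLogSU (n := n))) j U₀) c i) ≤ a j) →
      (∀ j < k, a j ≤ 1 / 6) → (∀ j < k, a j < deltaSU n) →
      ∃ (Ω : Type) (_ : Fintype Ω) (τ : PBond P k → Ω → Matrix.specialUnitaryGroup n ℂ) (ρ : PBond P k → Ω → (Fin P.d → Fin (P.L ^ k)))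
        (t : PBond P k → Ω → ℕ) (W : PBond P k → Ω → List (Letter P.d)),
        (∀ c : PBond P k, S k c = (((Fintype.card (Idx P) : ℂ)) ^ k)⁻¹ • ∑ ω, ((τ c ω : Matrix.specialUnitaryGroup n ℂ) : Matrix n n ℂ)
            * Y ⟨(fun z : Site P 0 => z.shift c.dir)^[t c ω] (Site.fibreSite 0 k c.src (ρ c ω)), c.dir⟩ * star ((τ c ω : Matrix.specialUnitaryGroup n ℂ) : Matrix n n ℂ))
        ∧ (∀ c ω, t c ω < P.L ^ k)
        ∧ (∀ c ω, ‖((τ c ω : Matrix.specialUnitaryGroup n ℂ) : Matrix n n ℂ)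
            - ((holAt U₀ (walk (embIter k c.src) (W c ω)) : Matrix.specialUnitaryGroup n ℂ) : Matrix n n ℂ)‖ ≤ η k)
        ∧ (∀ c ω, (W c ω).length ≤ len k)
        ∧ (∀ c ω (ν : Fin P.d), netDisp (W c ω) ν = ((ρ c ω ν : ℕ) : ℤ) - (H k : ℤ) + (if ν = c.dir then ((t c ω : ℕ) : ℤ) else 0))
        ∧ (∀ (M : Type) [AddCommMonoid M] (c : PBond P k) (F : (Fin P.d → Fin (P.L ^ k)) → ℕ → M),
            ∑ ω, F (ρ c ω) (t c ω) = ((Fintype.card (Equiv.Perm (Fin P.d)) ^ 2) ^ k) • ∑ r : Fin P.d → Fin (P.L ^ k), ∑ s ∈ Finset.range (P.L ^ k), F r s) := by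
  intro k
  induction k with
  | zero =>
    intro _ _ _ _
    refine ⟨Unit, inferInstance, fun _ _ => 1, fun _ _ => fun _ => ⟨0, by simp⟩, fun _ _ => 0, fun _ _ => [], ?_, ?_, ?_, ?_, ?_, ?_⟩
    · intro c
      simp only [pow_zero, inv_one, one_smul, Finset.univ_unique, Finset.sum_singleton, Function.iterate_zero_apply, fibreSite_zero_const,
        OneMemClass.coe_one, star_one, one_mul, mul_one, hS0]
    · intro c ω; simp
    · intro c ω
      have h0 : embIter 0 c.src = c.src := rfl
      simp only [walk, holAt_nil, sub_self, norm_zero]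
      exact hη0
    · intro c ω; simp
    · intro c ω ν; simp [hH0]
    · intro M _ c F
      dsimp only
      have hrange : Finset.range (P.L ^ 0) = {0} := by rw [pow_zero, Finset.range_one]
      rw [show ((Fintype.card (Equiv.Perm (Fin P.d)) ^ 2) ^ 0) = 1 from pow_zero _, one_smul, hrange, Fintype.sum_unique]
      simp only [Finset.sum_singleton]
      have huniq : ∀ r : Fin P.d → Fin (P.L ^ 0), r = fun _ => ⟨0, by simp⟩ := by
        intro r; funext ν; apply Fin.ext; have := (r ν).isLt; simp only [pow_zero] at this; show (r ν : ℕ) = 0; omega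
      rw [Fintype.sum_eq_single (fun _ => (⟨0, by simp⟩ : Fin (P.L ^ 0))) (fun r hr => absurd (huniq r) hr)]
  | succ k ih =>
    intro hk hα h6 hN
    obtain ⟨Ω, hΩ, τ, ρ, t, W, h1, h2, h3, h4, h5, h6'⟩ :=
      ih (Nat.le_of_succ_le hk) (fun j hj => hα j (Nat.lt_succ_of_lt hj)) (fun j hj => h6 j (Nat.lt_succ_of_lt hj)) (fun j hj => hN j (Nat.lt_succ_of_lt hj))
    -- letters of the level-`k → k+1` step
    set V := Averaging.iter (fun i => blockAvg (P := P) (j := i) (expMeanLogSU (n := n))) k U₀ with hV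
    have h0k : P.sitesPerDir 0 = P.L ^ k * P.sitesPerDir k := sitesPerDir_zero_eq_pow_mul (Nat.le_of_succ_le hk)
    -- the child bond reached by `(r, t₁)` is `⟨shift^{t₁}(blockSite c₋ r), μ_c⟩` (`= shift^{t₁}(walkEnd (emb c₋) Γ_σ)` for every `σ`)
    -- `‖ab − a′b′‖ ≤ ‖a − a′‖ + ‖b − b′‖` for `‖b‖, ‖a′‖ ≤ 1`
    have hprod : ∀ {a₁ a₂ b₁ b₂ : Matrix n n ℂ}, ‖b₁‖ ≤ 1 → ‖a₂‖ ≤ 1 → ‖a₁ * b₁ - a₂ * b₂‖ ≤ ‖a₁ - a₂‖ + ‖b₁ - b₂‖ := by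
      intro a₁ a₂ b₁ b₂ hb ha
      have e : a₁ * b₁ - a₂ * b₂ = (a₁ - a₂) * b₁ + a₂ * (b₁ - b₂) := by noncomm_ring
      rw [e]
      calc _ ≤ ‖a₁ - a₂‖ * ‖b₁‖ + ‖a₂‖ * ‖b₁ - b₂‖ := (norm_add_le _ _).trans (add_le_add (norm_mul_le _ _) (norm_mul_le _ _))
        _ ≤ ‖a₁ - a₂‖ * 1 + 1 * ‖b₁ - b₂‖ := add_le_add (mul_le_mul_of_nonneg_left hb (norm_nonneg _)) (mul_le_mul_of_nonneg_right ha (norm_nonneg _))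
        _ = ‖a₁ - a₂‖ + ‖b₁ - b₂‖ := by ring
    -- length of a dilated word
    have hlen_flatMap : ∀ (w : List (Letter P.d)) (s : ℕ), (w.flatMap fun l => List.replicate s l).length = w.length * s := by
      intro w s
      induction w with
      | nil => simp
      | cons l w ihw => rw [List.flatMap_cons, List.length_append, List.length_replicate, ihw, List.length_cons]; ring
    refine ⟨Idx P × Fin P.L × Ω, inferInstance,
      fun c p => holAt V (walk (emb c.src) (stairWord p.1.2.1 (off p.1.1)))
        * holAt V (walk (walkEnd (emb c.src) (stairWord p.1.2.1 (off p.1.1))) (List.replicate (p.2.1 : ℕ) (c.dir, true))) * τ (⟨(fun z : Site P k => z.shift c.dir)^[(p.2.1 : ℕ)] (Site.blockSite c.src p.1.1), c.dir⟩ : PBond P k) p.2.2,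
      fun c p => fun ν => finCongr (pow_succ' P.L k).symm (finProdFinEquiv (p.1.1 ν, ρ (⟨(fun z : Site P k => z.shift c.dir)^[(p.2.1 : ℕ)] (Site.blockSite c.src p.1.1), c.dir⟩ : PBond P k) p.2.2 ν)),
      fun c p => (p.2.1 : ℕ) * P.L ^ k + t (⟨(fun z : Site P k => z.shift c.dir)^[(p.2.1 : ℕ)] (Site.blockSite c.src p.1.1), c.dir⟩ : PBond P k) p.2.2,
      fun c p => ((stairWord p.1.2.1 (off p.1.1) ++ List.replicate (p.2.1 : ℕ) (c.dir, true)).flatMap fun l => List.replicate (P.L ^ k) l) ++ W (⟨(fun z : Site P k => z.shift c.dir)^[(p.2.1 : ℕ)] (Site.blockSite c.src p.1.1), c.dir⟩ : PBond P k) p.2.2,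
      ?_, ?_, ?_, ?_, ?_, ?_⟩
    · -- (I1): one level of `LINE` on the transported family of level `k`
      intro c
      -- the level-`k` family with the scalar pushed inside
      have hZ : ∀ b : PBond P k, S k b = ∑ ω, ((τ b ω : Matrix.specialUnitaryGroup n ℂ) : Matrix n n ℂ)
          * ((fun b₀ : PBond P 0 => (((Fintype.card (Idx P) : ℂ)) ^ k)⁻¹ • Y b₀)
              ⟨(fun z : Site P 0 => z.shift b.dir)^[t b ω] (Site.fibreSite 0 k b.src (ρ b ω)), b.dir⟩)
          * star ((τ b ω : Matrix.specialUnitaryGroup n ℂ) : Matrix n n ℂ) := by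
        intro b
        rw [h1 b, Finset.smul_sum]
        refine Finset.sum_congr rfl fun ω _ => ?_
        rw [Matrix.mul_smul, Matrix.smul_mul]
      rw [hSs, line_of_transported_family_fin V τ
        (fun b ω => (⟨(fun z : Site P 0 => z.shift b.dir)^[t b ω] (Site.fibreSite 0 k b.src (ρ b ω)), b.dir⟩ : PBond P 0))
        (fun b₀ : PBond P 0 => (((Fintype.card (Idx P) : ℂ)) ^ k)⁻¹ • Y b₀) (S k) hZ c]
      conv_rhs => rw [show ((((Fintype.card (Idx P) : ℂ)) ^ (k + 1))⁻¹) = ((Fintype.card (Idx P) : ℂ))⁻¹ * ((((Fintype.card (Idx P) : ℂ)) ^ k)⁻¹) by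
          rw [pow_succ, mul_inv, mul_comm], mul_smul, Finset.smul_sum]
      congr 1
      refine Finset.sum_congr rfl fun p _ => ?_
      dsimp only
      simp only [walkEnd_emb_stairWord_eq_blockSite]
      -- the reached bond in `(k+1)`-one-stroke coordinates
      have hsrc : (fun z : Site P 0 => z.shift c.dir)^[t (⟨(fun z : Site P k => z.shift c.dir)^[(p.2.1 : ℕ)] (Site.blockSite c.src p.1.1), c.dir⟩ : PBond P k) p.2.2] (Site.fibreSite 0 k ((fun z : Site P k => z.shift c.dir)^[(p.2.1 : ℕ)] (Site.blockSite c.src p.1.1)) (ρ (⟨(fun z : Site P k => z.shift c.dir)^[(p.2.1 : ℕ)] (Site.blockSite c.src p.1.1), c.dir⟩ : PBond P k) p.2.2))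
          = (fun z : Site P 0 => z.shift c.dir)^[(p.2.1 : ℕ) * P.L ^ k + t (⟨(fun z : Site P k => z.shift c.dir)^[(p.2.1 : ℕ)] (Site.blockSite c.src p.1.1), c.dir⟩ : PBond P k) p.2.2]
              (Site.fibreSite 0 (k + 1) c.src (fun ν => finCongr (pow_succ' P.L k).symm (finProdFinEquiv (p.1.1 ν, ρ (⟨(fun z : Site P k => z.shift c.dir)^[(p.2.1 : ℕ)] (Site.blockSite c.src p.1.1), c.dir⟩ : PBond P k) p.2.2 ν)))) :=
        oneStroke_src_succ hk h0k c.src c.dir p.1.1 (p.2.1 : ℕ) (ρ (⟨(fun z : Site P k => z.shift c.dir)^[(p.2.1 : ℕ)] (Site.blockSite c.src p.1.1), c.dir⟩ : PBond P k) p.2.2) (t (⟨(fun z : Site P k => z.shift c.dir)^[(p.2.1 : ℕ)] (Site.blockSite c.src p.1.1), c.dir⟩ : PBond P k) p.2.2)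
      show _ = ((((Fintype.card (Idx P) : ℂ)) ^ k)⁻¹) • _
      rw [← hsrc, Matrix.mul_smul, Matrix.smul_mul]
    · -- (I2): `t' = t₁L^k + t_k < L^{k+1}`
      intro c p
      dsimp only
      have h := h2 (⟨(fun z : Site P k => z.shift c.dir)^[(p.2.1 : ℕ)] (Site.blockSite c.src p.1.1), c.dir⟩ : PBond P k) p.2.2
      have ht1 := p.2.1.isLt
      calc (p.2.1 : ℕ) * P.L ^ k + t (⟨(fun z : Site P k => z.shift c.dir)^[(p.2.1 : ℕ)] (Site.blockSite c.src p.1.1), c.dir⟩ : PBond P k) p.2.2 < (p.2.1 : ℕ) * P.L ^ k + P.L ^ k := by omega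
        _ = ((p.2.1 : ℕ) + 1) * P.L ^ k := by ring
        _ ≤ P.L * P.L ^ k := Nat.mul_le_mul_right _ ht1
        _ = P.L ^ (k + 1) := by rw [pow_succ']
    · -- (I3): transports versus `U₀`-holonomies of the concatenated dilated word
      intro c p
      dsimp only
      set w : List (Letter P.d) := stairWord p.1.2.1 (off p.1.1) ++ List.replicate (p.2.1 : ℕ) (c.dir, true) with hw
      have hD' : holAt V (walk (emb c.src) (stairWord p.1.2.1 (off p.1.1)))
            * holAt V (walk (walkEnd (emb c.src) (stairWord p.1.2.1 (off p.1.1))) (List.replicate (p.2.1 : ℕ) (c.dir, true)))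
          = holAt V (walk (emb c.src) w) := by rw [hw, holAt_walk_append]
      have hend : walkEnd (embIter k (emb c.src)) (w.flatMap fun l => List.replicate (P.L ^ k) l) = embIter k ((fun z : Site P k => z.shift c.dir)^[(p.2.1 : ℕ)] (Site.blockSite c.src p.1.1)) := by
        rw [walkEnd_embIter_flatMap, hw, walkEnd_append, walkEnd_replicate_true_eq_iterate, walkEnd_emb_stairWord_eq_blockSite]
      have hsplit : holAt U₀ (walk (embIter (k + 1) c.src) ((w.flatMap fun l => List.replicate (P.L ^ k) l) ++ W (⟨(fun z : Site P k => z.shift c.dir)^[(p.2.1 : ℕ)] (Site.blockSite c.src p.1.1), c.dir⟩ : PBond P k) p.2.2))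
          = holAt U₀ (walk (embIter k (emb c.src)) (w.flatMap fun l => List.replicate (P.L ^ k) l))
            * holAt U₀ (walk (embIter k ((fun z : Site P k => z.shift c.dir)^[(p.2.1 : ℕ)] (Site.blockSite c.src p.1.1))) (W (⟨(fun z : Site P k => z.shift c.dir)^[(p.2.1 : ℕ)] (Site.blockSite c.src p.1.1), c.dir⟩ : PBond P k) p.2.2)) := by
        rw [show embIter (k + 1) c.src = embIter k (emb c.src) from rfl, holAt_walk_append, hend]
      have hlenw_nat : w.length ≤ (P.d + 2) * P.L := by
        rw [hw, List.length_append, List.length_replicate]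
        have hs : (stairWord p.1.2.1 (off p.1.1)).length ≤ P.d * ((P.L - 1) / 2) :=
          LatticeWordStokes.length_stairWord_le p.1.2.1 (off p.1.1) ((P.L - 1) / 2) (fun ν => by have := off_bounds p.1.1 ν; omega)
        have h2' := p.2.1.isLt
        have h3' : P.d * ((P.L - 1) / 2) ≤ P.d * P.L := Nat.mul_le_mul_left _ (by omega)
        nlinarith
      have hlenw : (w.length : ℝ) ≤ (((P.d + 2) * P.L : ℕ) : ℝ) := by exact_mod_cast hlenw_nat
      have hB := norm_holAt_iter_walk_sub_dilated_le U₀ a θ (hθ0 0) hθ (k := k)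
        (fun j hj => hα j (Nat.lt_succ_of_lt hj)) (fun j hj => h6 j (Nat.lt_succ_of_lt hj)) (fun j hj => hN j (Nat.lt_succ_of_lt hj)) (emb c.src) w
      have hE := h3 (⟨(fun z : Site P k => z.shift c.dir)^[(p.2.1 : ℕ)] (Site.blockSite c.src p.1.1), c.dir⟩ : PBond P k) p.2.2
      rw [hD', hsplit, Submonoid.coe_mul, Submonoid.coe_mul]
      calc _ ≤ ‖((holAt V (walk (emb c.src) w) : Matrix.specialUnitaryGroup n ℂ) : Matrix n n ℂ)
              - ((holAt U₀ (walk (embIter k (emb c.src)) (w.flatMap fun l => List.replicate (P.L ^ k) l)) : Matrix.specialUnitaryGroup n ℂ) : Matrix n n ℂ)‖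
            + ‖((τ (⟨(fun z : Site P k => z.shift c.dir)^[(p.2.1 : ℕ)] (Site.blockSite c.src p.1.1), c.dir⟩ : PBond P k) p.2.2 : Matrix.specialUnitaryGroup n ℂ) : Matrix n n ℂ)
              - ((holAt U₀ (walk (embIter k ((fun z : Site P k => z.shift c.dir)^[(p.2.1 : ℕ)] (Site.blockSite c.src p.1.1))) (W (⟨(fun z : Site P k => z.shift c.dir)^[(p.2.1 : ℕ)] (Site.blockSite c.src p.1.1), c.dir⟩ : PBond P k) p.2.2)) : Matrix.specialUnitaryGroup n ℂ) : Matrix n n ℂ)‖ :=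
          hprod (norm_coe_eq_one _).le (norm_coe_eq_one _).le
        _ ≤ w.length * θ k + η k := add_le_add hB hE
        _ ≤ (((P.d + 2) * P.L : ℕ) : ℝ) * θ k + η k := by nlinarith [hθ0 k]
        _ ≤ η (k + 1) := hη k
    · -- (I4): lengths
      intro c p
      dsimp only
      rw [List.length_append, hlen_flatMap]
      have hk4 := h4 (⟨(fun z : Site P k => z.shift c.dir)^[(p.2.1 : ℕ)] (Site.blockSite c.src p.1.1), c.dir⟩ : PBond P k) p.2.2
      have hwlen : (stairWord p.1.2.1 (off p.1.1) ++ List.replicate (p.2.1 : ℕ) (c.dir, true)).length ≤ (P.d + 2) * P.L := by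
        rw [List.length_append, List.length_replicate]
        have hs : (stairWord p.1.2.1 (off p.1.1)).length ≤ P.d * ((P.L - 1) / 2) :=
          LatticeWordStokes.length_stairWord_le p.1.2.1 (off p.1.1) ((P.L - 1) / 2) (fun ν => by have := off_bounds p.1.1 ν; omega)
        have h2' := p.2.1.isLt
        have h3' : P.d * ((P.L - 1) / 2) ≤ P.d * P.L := Nat.mul_le_mul_left _ (by omega)
        nlinarith
      calc (stairWord p.1.2.1 (off p.1.1) ++ List.replicate (p.2.1 : ℕ) (c.dir, true)).length * P.L ^ k + (W (⟨(fun z : Site P k => z.shift c.dir)^[(p.2.1 : ℕ)] (Site.blockSite c.src p.1.1), c.dir⟩ : PBond P k) p.2.2).length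
          ≤ (P.d + 2) * P.L * P.L ^ k + len k := add_le_add (Nat.mul_le_mul_right _ hwlen) hk4
        _ = P.L ^ k * ((P.d + 2) * P.L) + len k := by ring
        _ ≤ len (k + 1) := hlen k
    · -- (I5): net displacements
      intro c p ν
      dsimp only
      rw [netDisp_append, netDisp_flatMap_replicate, netDisp_append, netDisp_stairWord, netDisp_replicate, h5 (⟨(fun z : Site P k => z.shift c.dir)^[(p.2.1 : ℕ)] (Site.blockSite c.src p.1.1), c.dir⟩ : PBond P k) p.2.2 ν, hH k]
      dsimp only
      simp only [off, finCongr_apply, Fin.val_cast, finProdFinEquiv_apply_val]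
      by_cases hν : ν = c.dir
      · subst hν
        simp only [if_true]
        push_cast
        ring
      · rw [if_neg hν, if_neg hν, if_neg (Ne.symm hν)]
        push_cast
        ring
    · -- (I6): multiplicities (the one-stroke split, the two permutation indices idle)
      intro M _ c F
      dsimp only
      rw [Fintype.sum_prod_type]
      have hinner : ∀ i : Idx P, ∑ q : Fin P.L × Ω,
          F (fun ν => finCongr (pow_succ' P.L k).symm (finProdFinEquiv (i.1 ν,
              ρ (⟨(fun z : Site P k => z.shift c.dir)^[(q.1 : ℕ)] (Site.blockSite c.src i.1), c.dir⟩ : PBond P k) q.2 ν)))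
            ((q.1 : ℕ) * P.L ^ k + t (⟨(fun z : Site P k => z.shift c.dir)^[(q.1 : ℕ)] (Site.blockSite c.src i.1), c.dir⟩ : PBond P k) q.2)
          = (Fintype.card (Equiv.Perm (Fin P.d)) ^ 2) ^ k • ∑ t₁ ∈ Finset.range P.L, ∑ r₀ : Fin P.d → Fin (P.L ^ k), ∑ s ∈ Finset.range (P.L ^ k),
              F (fun ν => finCongr (pow_succ' P.L k).symm (finProdFinEquiv (i.1 ν, r₀ ν))) (t₁ * P.L ^ k + s) := by
        intro i
        rw [Fintype.sum_prod_type, Finset.smul_sum,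
          ← Fin.sum_univ_eq_sum_range (fun t₁ => (Fintype.card (Equiv.Perm (Fin P.d)) ^ 2) ^ k • ∑ r₀ : Fin P.d → Fin (P.L ^ k), ∑ s ∈ Finset.range (P.L ^ k),
              F (fun ν => finCongr (pow_succ' P.L k).symm (finProdFinEquiv (i.1 ν, r₀ ν))) (t₁ * P.L ^ k + s)) P.L]
        refine Finset.sum_congr rfl fun t₁ _ => ?_
        exact h6' M (⟨(fun z : Site P k => z.shift c.dir)^[(t₁ : ℕ)] (Site.blockSite c.src i.1), c.dir⟩ : PBond P k)
          (fun r₀ s => F (fun ν => finCongr (pow_succ' P.L k).symm (finProdFinEquiv (i.1 ν, r₀ ν))) ((t₁ : ℕ) * P.L ^ k + s))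
      have hinner' := fun i (_ : i ∈ (Finset.univ : Finset (Idx P))) => hinner i
      rw [Finset.sum_congr rfl hinner', ← Finset.smul_sum,
        sum_idx_of_fst (fun r : Fin P.d → Fin P.L => ∑ t₁ ∈ Finset.range P.L, ∑ r₀ : Fin P.d → Fin (P.L ^ k), ∑ s ∈ Finset.range (P.L ^ k),
          F (fun ν => finCongr (pow_succ' P.L k).symm (finProdFinEquiv (r ν, r₀ ν))) (t₁ * P.L ^ k + s)),
        sum_oneStroke_succ F, smul_smul, ← pow_succ]

end Summit.QuantumFields.YangMills.Theorems.Prop7LineIterRepr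

end
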